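import Literature.Probability.LatticeModels.MeshStrayExtent
import HarnessLib

/-!
# The largest mesh component of a Jordan domain is the bulk

Topic: Probability / LatticeModels (last file of the series `MeshColumns`, `MeshCells`,
`MeshLoops`, `MeshStrayParity`, `MeshGoodColumn`, `MeshWindows`, `MeshStrayExtent`). H21
discretises a planar domain `Ω` at mesh `δ` by `meshDomain Ω δ`, the union of the connected
components *of maximal cardinality* of the mesh graph on `Ω ∩ δℤ²` ("the largest connected
component", Smirnov 2001, §2). `MeshDomainBulk.lean` proved that this is the *bulk* (the
component of the lattice points of any fixed compact `K ⊆ Ω`) when `∂Ω` is Lebesgue-null. Here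
the proviso is removed for **Jordan domains**:

**Theorem** (`JordanDomain.exists_forall_mem_meshDomain_and_reachable`). For a Jordan domain
`D` and a compact `K ⊆ D.carrier`, for all small `δ > 0` every lattice point with mesh point in
`K` lies in `meshDomain D.carrier δ`, which is a single mesh component.

Proof. As in `MeshDomainBulk.lean`, all lattice points at distance `≥ ε` from `Ωᶜ` lie in one
component `B` with `≥ 3·area(Ω) / (4 δ² area B(0,1))` points (for `ε` small). Any other
component `C` is *stray* — all its points are within `ε` of `Ωᶜ` — so by
`JordanDomain.mul_sub_lt_of_stray` (with `D₀ = area Ω / (64 R area B(0,1))`, `Ω ⊆ B̄(0, R)`)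
its horizontal extent is `< D₀`; as its vertical extent is `≤ 2R`, it has at most
`15 D₀ R / δ² < #B` points. Hence `B` is the unique largest component. No hypothesis on the area
of the boundary curve (Osgood curves included); this is what the crossing-probability corollary
`discreteCrossingProb_clusterPt_mem_Ioo` of RSW needs for H21's discretisation.

Folklore (no source; see the module docstrings of the series). Mathlib anchors: `Set.ncard`,
`SimpleGraph.ConnectedComponent.supp`, `Finset.Ioo`, `Finset.Icc`. H21 anchors:
`exists_isOpen_isPreconnected_bulk`, `meshVertexGraph_reachable_of_mem_bulk`,
`volume_real_le_ncard_mul`, `exists_pos_volume_real_innerCollar_lt` (`MeshDomainBulk.lean`),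
`JordanDomain.mul_sub_lt_of_stray` (`MeshStrayExtent.lean`).
-/

namespace Literature.Probability.RandomPlanarGeometry.JordanDomain

open Set Metric MeasureTheory Literature.Probability.LatticeModels

noncomputable section

/-- Lattice points whose first coordinate is within `N₁` of `c` and whose second coordinate is at
most `N₂` in absolute value are at most `#(Ioo (c-N₁) (c+N₁)) · #(Icc (-N₂) N₂)`. [folklore] -/
theorem ncard_le_of_coord_bounds {S : Set (Site 2)} {c N₁ N₂ : ℤ}
    (h : ∀ y ∈ S, |y 0 - c| < N₁ ∧ |y 1| ≤ N₂) :
    S.ncard ≤ ((Finset.Ioo (c - N₁) (c + N₁)) ×ˢ (Finset.Icc (-N₂) N₂)).card := by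
  set f : Site 2 → ℤ × ℤ := fun y => (y 0, y 1) with hf
  have hfi : Function.Injective f := by
    intro y y' hy
    simp only [hf, Prod.mk.injEq] at hy
    funext l; fin_cases l
    · exact hy.1
    · exact hy.2
  rw [← Set.ncard_image_of_injective S hfi, ← Set.ncard_coe_finset]
  refine Set.ncard_le_ncard ?_ (Finset.finite_toSet _)
  rintro _ ⟨y, hy, rfl⟩
  obtain ⟨h1, h2⟩ := h y hy
  rw [abs_lt] at h1
  rw [abs_le] at h2
  simp only [Finset.coe_product, Finset.coe_Ioo, Finset.coe_Icc, mem_prod, mem_Ioo, mem_Icc, hf]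
  refine ⟨⟨by omega, by omega⟩, h2.1, h2.2⟩

/-- **The largest mesh component is the bulk (every Jordan domain).** For a Jordan domain `D`
and a compact `K ⊆ D.carrier`, for all sufficiently small mesh `δ > 0`:
* every lattice point of `δℤ²` whose mesh point lies in `K` belongs to the discrete domain
  `meshDomain D.carrier δ` (the union of the connected components of maximal cardinality of the
  mesh graph on `D.carrier ∩ δℤ²`), and
* `meshDomain D.carrier δ` is a single connected component of that mesh graph.
See the module docstring for the proof. [folklore] -/
theorem exists_forall_mem_meshDomain_and_reachable (D : JordanDomain) {K : Set ℂ}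
    (hK : IsCompact K) (hKΩ : K ⊆ D.carrier) :
    ∃ δ₀ > 0, ∀ δ, 0 < δ → δ < δ₀ →
      (∀ x : Site 2, meshPoint δ x ∈ K → x ∈ meshDomain D.carrier δ) ∧
      (∀ x ∈ meshDomain D.carrier δ, ∀ y ∈ meshDomain D.carrier δ,
        ∃ (hx : x ∈ meshVertices D.carrier δ) (hy : y ∈ meshVertices D.carrier δ),
          (meshVertexGraph D.carrier δ).Reachable ⟨x, hx⟩ ⟨y, hy⟩) := by
  classical
  set Ω := D.carrier with hΩ_def
  have hΩo : IsOpen Ω := D.isOpen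
  have hΩb : Bornology.IsBounded Ω := D.isBounded
  have hΩc : IsConnected Ω := D.isConnected
  have hΩne : Ω.Nonempty := hΩc.nonempty
  have hΩuniv : Ω ≠ univ := fun h => NormedSpace.unbounded_univ ℝ ℂ (h ▸ hΩb)
  have hne : Ωᶜ.Nonempty := nonempty_compl.2 hΩuniv
  set v : ℝ := volume.real (ball (0 : ℂ) 1) with hv_def
  have hv : 0 < v :=
    ENNReal.toReal_pos (measure_ball_pos volume (0 : ℂ) one_pos).ne' measure_ball_lt_top.ne
  set m : ℝ := volume.real Ω with hm_def
  have hm : 0 < m := ENNReal.toReal_pos (hΩo.measure_pos volume hΩne).ne' hΩb.measure_lt_top.ne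
  -- a radius `R ≥ 1` with `Ω ⊆ B̄(0, R)`
  obtain ⟨R₀, hR₀⟩ := (Metric.isBounded_iff_subset_closedBall (0 : ℂ)).1 hΩb
  set R : ℝ := max R₀ 1 with hR_def
  have hR1 : 1 ≤ R := le_max_right _ _
  have hR : 0 < R := by linarith
  have hΩR : Ω ⊆ closedBall (0 : ℂ) R := hR₀.trans (closedBall_subset_closedBall (le_max_left _ _))
  -- the horizontal extent allowed to stray components
  set D₀ : ℝ := m / (64 * R * v) with hD₀_def
  have hD₀ : 0 < D₀ := by positivity
  obtain ⟨ε₁, hε₁, δ₁, hδ₁, hnms⟩ := D.mul_sub_lt_of_stray hD₀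
  -- the collar
  obtain ⟨r₁, hr₁, hT⟩ := exists_pos_volume_real_innerCollar_lt hΩo hΩb hne (by positivity : 0 < m / 4)
  set ε : ℝ := min ε₁ (r₁ / 2) with hε_def
  have hε : 0 < ε := by positivity
  have hεε₁ : ε ≤ ε₁ := min_le_left _ _
  have hεr₁ : 2 * ε ≤ r₁ := by have := min_le_right ε₁ (r₁ / 2); rw [← hε_def] at this; linarith
  -- the big compact and the bulk neighbourhood
  set Kbig : Set ℂ := {z | ε ≤ infDist z Ωᶜ} with hKbig_def
  have hKbigΩ : Kbig ⊆ Ω := fun z hz => by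
    by_contra h
    have : infDist z Ωᶜ = 0 := infDist_zero_of_mem h
    have hz' : ε ≤ infDist z Ωᶜ := hz
    linarith
  have hKbigc : IsCompact Kbig :=
    Metric.isCompact_of_isClosed_isBounded (isClosed_le continuous_const (continuous_infDist_pt _))
      (hΩb.subset hKbigΩ)
  obtain ⟨V, -, hVc, hKV, -, ρ, hρ, hVρ⟩ :=
    exists_isOpen_isPreconnected_bulk hΩo hΩc hne (hK.union hKbigc) (union_subset hKΩ hKbigΩ)
  have hVΩ : ∀ w ∈ V, ball w ρ ⊆ Ω := fun w hw =>
    (ball_subset_ball (hVρ w hw).le).trans ball_infDist_compl_subset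
  -- the threshold
  refine ⟨min (ρ / 3) (min ε (min (δ₁ / 2) (D₀ / 2))), by positivity, fun δ hδ hδlt => ?_⟩
  have hδρ : 3 * δ ≤ ρ := by have := hδlt.le.trans (min_le_left _ _); linarith
  have hδε : δ ≤ ε := hδlt.le.trans ((min_le_right _ _).trans (min_le_left _ _))
  have hδδ₁ : δ < δ₁ := by
    have := hδlt.le.trans ((min_le_right _ _).trans ((min_le_right _ _).trans (min_le_left _ _)))
    linarith
  have hδD₀ : δ ≤ D₀ := by
    have := hδlt.le.trans ((min_le_right _ _).trans ((min_le_right _ _).trans (min_le_right _ _)))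
    linarith
  have hδR : δ ≤ R := by
    have : D₀ ≤ R := by
      rw [hD₀_def, div_le_iff₀ (by positivity)]
      -- `m ≤ area B̄(0,R) ≤ …` is not needed: crude bound `m ≤ 64 R² v` from `Ω ⊆ B(0, 2R)`
      have hmball : m ≤ volume.real (ball (0 : ℂ) (2 * R)) :=
        measureReal_mono (hΩR.trans (closedBall_subset_ball (by linarith)))
          measure_ball_lt_top.ne
      rw [← Measure.addHaar_real_closedBall_eq_addHaar_real_ball volume 0 (2 * R),
        Measure.addHaar_real_closedBall volume _ (by positivity : (0 : ℝ) ≤ 2 * R),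
        Complex.finrank_real_complex] at hmball
      nlinarith [mul_pos hR hv, sq_nonneg R]
    linarith
  set G := meshVertexGraph Ω δ with hG_def
  set P : Set (Site 2) := {x | meshPoint δ x ∈ Ω ∧ ε ≤ infDist (meshPoint δ x) Ωᶜ} with hP_def
  have hfinV : (meshVertices Ω δ).Finite := meshVertices_finite hΩb hδ
  -- the lower count
  have hL := volume_real_le_ncard_mul hΩb hδ hδε
  have hTmono : volume.real {z ∈ Ω | infDist z Ωᶜ < 2 * ε} ≤
      volume.real {z ∈ Ω | infDist z Ωᶜ < r₁} :=
    measureReal_mono (fun z hz => ⟨hz.1, hz.2.trans_le hεr₁⟩)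
      (hΩb.subset fun z hz => hz.1).measure_lt_top.ne
  have hsplit : m ≤ volume.real {z ∈ Ω | 2 * ε ≤ infDist z Ωᶜ} +
      volume.real {z ∈ Ω | infDist z Ωᶜ < 2 * ε} := by
    have hcov : Ω ⊆ {z ∈ Ω | 2 * ε ≤ infDist z Ωᶜ} ∪ {z ∈ Ω | infDist z Ωᶜ < 2 * ε} := by
      intro z hz
      rcases le_or_gt (2 * ε) (infDist z Ωᶜ) with h | h
      · exact Or.inl ⟨hz, h⟩
      · exact Or.inr ⟨hz, h⟩
    calc m ≤ volume.real ({z ∈ Ω | 2 * ε ≤ infDist z Ωᶜ} ∪ {z ∈ Ω | infDist z Ωᶜ < 2 * ε}) :=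
          measureReal_mono hcov ((hΩb.subset (union_subset (fun z hz => hz.1)
            (fun z hz => hz.1))).measure_lt_top.ne)
      _ ≤ _ := measureReal_union_le _ _
  have hPlow : 3 * m / 4 ≤ (P.ncard : ℝ) * (δ ^ 2 * v) := by linarith
  -- the bulk component `B`
  have hPpos : 0 < P.ncard := by
    have : (0 : ℝ) < P.ncard := by
      have h1 : (0 : ℝ) < 3 * m / 4 := by positivity
      have h2 : (0 : ℝ) < δ ^ 2 * v := by positivity
      by_contra h0
      push Not at h0
      have : (P.ncard : ℝ) * (δ ^ 2 * v) ≤ 0 := mul_nonpos_of_nonpos_of_nonneg h0 h2.le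
      linarith
    exact_mod_cast this
  obtain ⟨x₀, hx₀⟩ : P.Nonempty := nonempty_of_ncard_ne_zero (by omega)
  have hPV : ∀ x ∈ P, meshPoint δ x ∈ V := fun x hx => hKV (Or.inr hx.2)
  have hx₀Ω : x₀ ∈ meshVertices Ω δ := hx₀.1
  set B : G.ConnectedComponent := G.connectedComponentMk ⟨x₀, hx₀Ω⟩ with hB_def
  have hVB : ∀ x, meshPoint δ x ∈ V →
      ∃ hx : x ∈ meshVertices Ω δ, G.connectedComponentMk ⟨x, hx⟩ = B := by
    intro x hx
    obtain ⟨hx', hx₀', hr⟩ :=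
      meshVertexGraph_reachable_of_mem_bulk hδ hδρ hVc hVΩ hx (hPV x₀ hx₀)
    exact ⟨hx', SimpleGraph.ConnectedComponent.sound hr⟩
  -- points of any other component are shallow
  have hCbad : ∀ C : G.ConnectedComponent, C ≠ B → ∀ y ∈ C.supp,
      infDist (meshPoint δ (y : Site 2)) Ωᶜ < ε := by
    rintro C hCB ⟨y, hyΩ⟩ hyC
    by_contra hlt
    have hyP : y ∈ P := ⟨hyΩ, not_lt.1 hlt⟩
    obtain ⟨hy', hyB⟩ := hVB y (hPV y hyP)
    rw [SimpleGraph.ConnectedComponent.mem_supp_iff] at hyC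
    exact hCB (hyC.symm.trans hyB)
  have hPB : P ⊆ Subtype.val '' B.supp := fun x hx => by
    obtain ⟨hx', hxB⟩ := hVB x (hPV x hx)
    exact ⟨⟨x, hx'⟩, (SimpleGraph.ConnectedComponent.mem_supp_iff _ _).2 hxB, rfl⟩
  have hfinB : (Subtype.val '' B.supp).Finite :=
    hfinV.subset (by rintro _ ⟨y, -, rfl⟩; exact y.2)
  -- stray components are thin: the counting
  set N₁ : ℤ := ⌈D₀ / δ⌉ with hN₁
  set N₂ : ℤ := ⌈R / δ⌉ with hN₂
  have hN₁1 : (N₁ : ℝ) < D₀ / δ + 1 := Int.ceil_lt_add_one _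
  have hN₁0 : D₀ / δ ≤ N₁ := Int.le_ceil _
  have hN₂1 : (N₂ : ℝ) < R / δ + 1 := Int.ceil_lt_add_one _
  have hN₂0 : R / δ ≤ N₂ := Int.le_ceil _
  have hD₀δ : 1 ≤ D₀ / δ := by rw [le_div_iff₀ hδ]; linarith
  have hRδ : 1 ≤ R / δ := by rw [le_div_iff₀ hδ]; linarith
  have hbox : (((Finset.Ioo (0 - N₁) (0 + N₁)) ×ˢ (Finset.Icc (-N₂) N₂)).card : ℝ) <
      3 * m / 4 / (δ ^ 2 * v) := by
    rw [Finset.card_product, Int.card_Ioo, Int.card_Icc, Nat.cast_mul]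
    have h1 : (((0 + N₁ - (0 - N₁) - 1).toNat : ℕ) : ℝ) ≤ 2 * (D₀ / δ) + 1 := by
      have hnn : (0 : ℤ) ≤ 0 + N₁ - (0 - N₁) - 1 := by
        have : (1 : ℝ) ≤ N₁ := hD₀δ.trans hN₁0
        have : (1 : ℤ) ≤ N₁ := by exact_mod_cast this
        omega
      have hc : (((0 + N₁ - (0 - N₁) - 1).toNat : ℕ) : ℝ) = ((0 + N₁ - (0 - N₁) - 1 : ℤ) : ℝ) := by
        rw [← Int.cast_natCast, Int.toNat_of_nonneg hnn]
      rw [hc]; push_cast; linarith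
    have h2 : (((N₂ + 1 - -N₂).toNat : ℕ) : ℝ) ≤ 2 * (R / δ) + 3 := by
      have hnn : (0 : ℤ) ≤ N₂ + 1 - -N₂ := by
        have : (1 : ℝ) ≤ N₂ := hRδ.trans hN₂0
        have : (1 : ℤ) ≤ N₂ := by exact_mod_cast this
        omega
      have hc : (((N₂ + 1 - -N₂).toNat : ℕ) : ℝ) = ((N₂ + 1 - -N₂ : ℤ) : ℝ) := by
        rw [← Int.cast_natCast, Int.toNat_of_nonneg hnn]
      rw [hc]; push_cast; linarith
    have h3 : (2 * (D₀ / δ) + 1) * (2 * (R / δ) + 3) ≤ 15 * (D₀ / δ) * (R / δ) := by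
      nlinarith
    have h4 : 15 * (D₀ / δ) * (R / δ) < 3 * m / 4 / (δ ^ 2 * v) := by
      rw [hD₀_def]
      rw [lt_div_iff₀ (by positivity)]
      have : 15 * (m / (64 * R * v) / δ) * (R / δ) * (δ ^ 2 * v) = 15 * m / 64 := by
        field_simp
      rw [this]
      linarith
    exact (mul_le_mul h1 h2 (by positivity) (by positivity)).trans_lt (h3.trans_lt h4)
  have hcardC : ∀ C : G.ConnectedComponent, C ≠ B → C.supp.ncard < B.supp.ncard := by
    intro C hCB
    rw [← ncard_image_of_injective C.supp Subtype.val_injective,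
      ← ncard_image_of_injective B.supp Subtype.val_injective]
    -- a base point of `C`
    obtain ⟨xc, hxc⟩ : C.supp.Nonempty := by
      induction C using SimpleGraph.ConnectedComponent.ind with
      | h w => exact ⟨w, rfl⟩
    have hstray : ∀ z : meshVertices Ω δ, G.Reachable xc z → infDist (meshPoint δ (z : Site 2)) Ωᶜ < ε₁ := by
      intro z hz
      refine (hCbad C hCB z ?_).trans_le hεε₁
      rw [SimpleGraph.ConnectedComponent.mem_supp_iff] at hxc ⊢
      rw [← hxc]
      exact SimpleGraph.ConnectedComponent.sound hz.symm
    have hcoord : ∀ y ∈ Subtype.val '' C.supp, |y 0 - (xc : Site 2) 0| < N₁ ∧ |y 1| ≤ N₂ := by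
      rintro _ ⟨y, hyC, rfl⟩
      have hreach : G.Reachable xc y := by
        rw [SimpleGraph.ConnectedComponent.mem_supp_iff] at hxc hyC
        exact SimpleGraph.ConnectedComponent.exact (hxc.trans hyC.symm)
      have h1 := hnms δ hδ hδδ₁ xc y hreach hstray
      have hstray' : ∀ z : meshVertices Ω δ, G.Reachable y z →
          infDist (meshPoint δ (z : Site 2)) Ωᶜ < ε₁ := fun z hz => hstray z (hreach.trans hz)
      have h2 := hnms δ hδ hδδ₁ y xc hreach.symm hstray'
      constructor
      · have ha : ((y : Site 2) 0 : ℝ) - (xc : Site 2) 0 < N₁ := by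
          have : δ * (((y : Site 2) 0 : ℝ) - (xc : Site 2) 0) < δ * N₁ := by
            calc δ * (((y : Site 2) 0 : ℝ) - (xc : Site 2) 0) < D₀ := h1
              _ = δ * (D₀ / δ) := by field_simp
              _ ≤ δ * N₁ := mul_le_mul_of_nonneg_left hN₁0 hδ.le
          exact lt_of_mul_lt_mul_left this hδ.le
        have hb : ((xc : Site 2) 0 : ℝ) - (y : Site 2) 0 < N₁ := by
          have : δ * (((xc : Site 2) 0 : ℝ) - (y : Site 2) 0) < δ * N₁ := by
            calc δ * (((xc : Site 2) 0 : ℝ) - (y : Site 2) 0) < D₀ := h2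
              _ = δ * (D₀ / δ) := by field_simp
              _ ≤ δ * N₁ := mul_le_mul_of_nonneg_left hN₁0 hδ.le
          exact lt_of_mul_lt_mul_left this hδ.le
        have ha' : (y : Site 2) 0 - (xc : Site 2) 0 < N₁ := by exact_mod_cast ha
        have hb' : (xc : Site 2) 0 - (y : Site 2) 0 < N₁ := by exact_mod_cast hb
        rw [abs_lt]; omega
      · have hyΩ : meshPoint δ (y : Site 2) ∈ closedBall (0 : ℂ) R := hΩR y.2
        rw [mem_closedBall, dist_zero_right] at hyΩ
        have him := (Complex.abs_im_le_norm _).trans hyΩ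
        rw [meshPoint_im, abs_mul, abs_of_pos hδ] at him
        have : (|((y : Site 2) 1 : ℝ)|) ≤ N₂ := by
          have : (|((y : Site 2) 1 : ℝ)|) ≤ R / δ := by rw [le_div_iff₀ hδ]; linarith
          exact this.trans hN₂0
        have : ((|(y : Site 2) 1| : ℤ) : ℝ) ≤ N₂ := by push_cast; exact this
        exact_mod_cast this
    have hC := ncard_le_of_coord_bounds hcoord
    have hC' : ((Subtype.val '' C.supp).ncard : ℝ) < 3 * m / 4 / (δ ^ 2 * v) := by
      refine lt_of_le_of_lt ?_ hbox
      have : ((Finset.Ioo ((xc : Site 2) 0 - N₁) ((xc : Site 2) 0 + N₁)) ×ˢ (Finset.Icc (-N₂) N₂)).card =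
          ((Finset.Ioo (0 - N₁) (0 + N₁)) ×ˢ (Finset.Icc (-N₂) N₂)).card := by
        rw [Finset.card_product, Finset.card_product, Int.card_Ioo, Int.card_Ioo]
        congr 2; omega
      rw [← this]
      exact_mod_cast hC
    have hP' : 3 * m / 4 / (δ ^ 2 * v) ≤ (P.ncard : ℝ) := by
      rw [div_le_iff₀ (by positivity)]; exact hPlow
    have : ((Subtype.val '' C.supp).ncard : ℝ) < (Subtype.val '' B.supp).ncard := by
      calc ((Subtype.val '' C.supp).ncard : ℝ) < P.ncard := hC'.trans_le hP'
        _ ≤ (Subtype.val '' B.supp).ncard := by exact_mod_cast ncard_le_ncard hPB hfinB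
    exact_mod_cast this
  -- so `Ω_δ` is exactly the set of points of `B`
  have hdom : meshDomain Ω δ = Subtype.val '' B.supp := by
    ext x
    simp only [meshDomain, mem_iUnion, mem_image]
    constructor
    · rintro ⟨C, hCmax, y, hyC, rfl⟩
      have hCB : C = B := by
        by_contra hCB
        exact (hcardC C hCB).not_ge (hCmax B)
      subst hCB
      exact ⟨y, hyC, rfl⟩
    · rintro ⟨y, hyB, rfl⟩
      refine ⟨B, fun C' => ?_, y, hyB, rfl⟩
      by_cases hC'B : C' = B
      · rw [hC'B]
      · exact (hcardC C' hC'B).le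
  refine ⟨fun x hxK => ?_, fun x hx y hy => ?_⟩
  · rw [hdom]
    obtain ⟨hx', hxB⟩ := hVB x (hKV (Or.inl hxK))
    exact ⟨⟨x, hx'⟩, (SimpleGraph.ConnectedComponent.mem_supp_iff _ _).2 hxB, rfl⟩
  · rw [hdom] at hx hy
    obtain ⟨⟨x', hx'⟩, hxB, rfl⟩ := hx
    obtain ⟨⟨y', hy'⟩, hyB, rfl⟩ := hy
    refine ⟨hx', hy', ?_⟩
    rw [SimpleGraph.ConnectedComponent.mem_supp_iff] at hxB hyB
    exact SimpleGraph.ConnectedComponent.exact (hxB.trans hyB.symm)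

/-- `𝓝[>] 0` phrasing: for all sufficiently small mesh, the lattice points of a compact
`K ⊆ D.carrier` belong to `meshDomain D.carrier δ`, which is connected in the mesh graph — for
**every** Jordan domain `D`. [folklore] -/
theorem eventually_forall_mem_meshDomain' (D : JordanDomain) {K : Set ℂ} (hK : IsCompact K)
    (hKD : K ⊆ D.carrier) :
    ∀ᶠ δ in nhdsWithin (0 : ℝ) (Set.Ioi 0),
      (∀ x : Site 2, meshPoint δ x ∈ K → x ∈ meshDomain D.carrier δ) ∧
      (∀ x ∈ meshDomain D.carrier δ, ∀ y ∈ meshDomain D.carrier δ,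
        ∃ (hx : x ∈ meshVertices D.carrier δ) (hy : y ∈ meshVertices D.carrier δ),
          (meshVertexGraph D.carrier δ).Reachable ⟨x, hx⟩ ⟨y, hy⟩) := by
  obtain ⟨δ₀, hδ₀, h⟩ := D.exists_forall_mem_meshDomain_and_reachable hK hKD
  filter_upwards [Ioo_mem_nhdsGT hδ₀] with δ hδ
  exact h δ hδ.1 hδ.2

end

end Literature.Probability.RandomPlanarGeometry.JordanDomain
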